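import Summits.ResolutionOfSingularities.ResolutionOfSingularities.Theorems.FrobeniusLadderFInjectiveMacaulayficationE8ChartYPoints
import Summits.ResolutionOfSingularities.ResolutionOfSingularities.Theorems.FrobeniusLadderFInjectiveMacaulayficationE7OffCentreRegular
import Mathlib.Algebra.MvPolynomial.PDeriv
import Mathlib.Algebra.CharP.Lemmas
import HarnessLib

/-!
# The `y`-chart of `Bl_𝔪(E₈⁰)` in characteristic `3` is regular along the exceptional divisor off `X₀ = 0`

Support file for crux stmt-ResolutionOfSingularities-15315
(`FrobeniusLadder.FInjectiveMacaulayfication`, line `Sketch`, seat c5): stub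
`stub_e8ChartYPrimesChar3` — the second step of the characteristic-`3` tower on the non-affine
`X₁ = Bl_𝔪 E₈⁰`, the characteristic-`3` / arbitrary-prime counterpart of
`E8ChartYPoints.clause_of_X_zero_notMem` (characteristic `5`, maximal ideals).

Let `k` be a field of characteristic `3` and `S = k[X₀, X₁, X₂]`. The `y`-chart of the point
blow-up of `E₈⁰ : z² + x³ + y⁵ = 0` is the hypersurface `S/(g_y)`, `g_y = X₂² + X₁X₀³ + X₁³`
(upstairs coordinates `X 0 = x/y`, `X 1 = y` — the equation of the exceptional divisor `E` — and
`X 2 = z/y`). The engine interface of the crux needs the per-stalk clause at every point of `X₁`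
except the bad `E₇⁰`-type point (the origin of this chart); on the `y`-chart this is regularity of
`(S/(g_y))_Q` at every PRIME `Q` with `X₀ ∉ P = Q ∩ S` (the primes containing both `X₀` and `X̄₁`
sit over the origin and are handled separately by the lead).

Proof (`stub_e8ChartYPrimesChar3`). In characteristic `3` the Jacobian direction `∂/∂X₁` is
`∂g_y/∂X₁ = X₀³ + 3X₁² = X₀³` (`E7OffCentreRegular.pderiv_one_e7`,
`E7OffCentreRegular.three_eq_zero_of_charP_three`; packaged as `pderiv_one_gy_char3`). Since `P` is
prime and `X₀ ∉ P`, also `X₀³ ∉ P` (`Ideal.IsPrime.mem_of_pow_mem`), i.e. `∂g_y/∂X₁ ∉ P`, and the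
Jacobian criterion at an arbitrary prime of a hypersurface
(`HypersurfaceRegular.stub_hypersurfaceRegularOfPderiv`, [Matsumura1987] Thm. 30.4 (ii)) gives that
`(S/(g_y))_Q` is a regular local ring. (The hypothesis `X̄₁ ∈ Q` of the registered form is not used:
in characteristic `3` the term `3X₁²` of `∂g_y/∂X₁` vanishes identically.)

References: H. Matsumura, *Commutative Ring Theory*, Cambridge Stud. Adv. Math. 8, CUP 1986,
Thm. 30.4 (ii) [Matsumura1987] (through the imported Jacobian criterion); M. Artin, *Coverings of
the rational double points in characteristic `p`*, in: Complex Analysis and Algebraic Geometry,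
Iwanami Shoten 1977 [Artin1977] (the forms `E₈⁰`, `E₇⁰` and `Bl_𝔪 E₈⁰ → E₇⁰`, context only). The
computation itself is folklore.
-/

-- single-problem summit: the doubled namespace component is forced
set_option linter.dupNamespace false

noncomputable section

namespace Summit.ResolutionOfSingularities.ResolutionOfSingularities.Theorems.FInjectiveMacaulayfication.E8ChartYPrimesChar3

open MvPolynomial
open Summit.ResolutionOfSingularities.ResolutionOfSingularities.Theorems.FInjectiveMacaulayfication

/-- **`∂g_y/∂X₁ = X₀³` in characteristic `3`** for `g_y = X₂² + X₁X₀³ + X₁³`: over any commutative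
ring `∂g_y/∂X₁ = X₀³ + C 3 · X₁²` (`E7OffCentreRegular.pderiv_one_e7`), and `(3 : k) = 0` in a field of
characteristic `3` (`E7OffCentreRegular.three_eq_zero_of_charP_three`). [folklore] -/
theorem pderiv_one_gy_char3 (k : Type) [Field k] [CharP k 3] (gy : MvPolynomial (Fin 3) k)
    (hgy : gy = X 2 ^ 2 + X 1 * X 0 ^ 3 + X 1 ^ 3) : pderiv 1 gy = X 0 ^ 3 := by
  rw [hgy, E7OffCentreRegular.pderiv_one_e7, E7OffCentreRegular.three_eq_zero_of_charP_three, C_0,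
    zero_mul, add_zero]

/-- **The `y`-chart of `Bl_𝔪 E₈⁰` in characteristic `3` is regular at the primes of the exceptional
divisor off `X₀ = 0`** (registered stub `stub_e8ChartYPrimesChar3` of line `Sketch`): for a field `k`
of characteristic `3`, `g_y = X₂² + X₁X₀³ + X₁³ ∈ S = k[X₀, X₁, X₂]` (the strict transform of
`z² + x³ + y⁵` on the chart `x = yu, z = yv`) and a prime `Q` of `S/(g_y)` with `X̄₁ ∈ Q` and
`X₀ ∉ P = Q ∩ S`, the local ring `(S/(g_y))_Q` is regular. Proof: `P` is prime, so `X₀³ ∉ P`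
(`Ideal.IsPrime.mem_of_pow_mem`), and `∂g_y/∂X₁ = X₀³` in characteristic `3` (`pderiv_one_gy_char3`);
hence `∂g_y/∂X₁ ∉ P` and the Jacobian criterion at an arbitrary prime of a hypersurface
(`HypersurfaceRegular.stub_hypersurfaceRegularOfPderiv`, direction `i = 1`) applies.
[cite: Matsumura1987, Thm. 30.4 (ii)] for the Jacobian criterion; the computation is folklore. -/
theorem stub_e8ChartYPrimesChar3 : ∀ (k : Type) [Field k] [CharP k 3] (gy : MvPolynomial (Fin 3) k),
    gy = MvPolynomial.X 2 ^ 2 + MvPolynomial.X 1 * MvPolynomial.X 0 ^ 3 + MvPolynomial.X 1 ^ 3 →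
    ∀ (Q : Ideal (MvPolynomial (Fin 3) k ⧸ Ideal.span {gy})) [Q.IsPrime],
      Ideal.Quotient.mk (Ideal.span {gy}) (MvPolynomial.X 1) ∈ Q →
      (MvPolynomial.X 0 : MvPolynomial (Fin 3) k) ∉ Q.comap (Ideal.Quotient.mk (Ideal.span {gy})) →
      IsRegularLocalRing (Localization.AtPrime Q) := by
  intro k _ _ gy hgy Q _ _ hX0
  haveI hprime : (Q.comap (Ideal.Quotient.mk (Ideal.span {gy}))).IsPrime := Ideal.comap_isPrime _ _
  -- Jacobian criterion in the direction `∂/∂X₁`, where `∂g_y/∂X₁ = X₀³ ∉ P = Q ∩ S`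
  refine HypersurfaceRegular.stub_hypersurfaceRegularOfPderiv k 3 gy 1 Q (fun hd => hX0 ?_)
  rw [pderiv_one_gy_char3 k gy hgy] at hd
  exact hprime.mem_of_pow_mem 3 hd

end Summit.ResolutionOfSingularities.ResolutionOfSingularities.Theorems.FInjectiveMacaulayfication.E8ChartYPrimesChar3

end
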